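import Mathlib
import Summits.MatrixMultiplication.MatrixMultiplication.Theses.ThinBlockAlpha
import Literature.Computability.AlgebraicComplexity.PrattTrapezoidValSTPP

/-!
# Sketch — crux-ideate round 1, ideator 3, crux `ThinBlockAlpha.ThinPackings` (stmt-MatrixMultiplication-10595)

First-lemma signatures for two idea cards (statements only; `def … : Prop`, no sorry):

* card `three-sphere-frame-designs`: `ThreeSpherePairCollapse` (provable now), `SuperlinearVal`,
  `CyclicThinRung`, `CyclicRungGivesSuperlinearVal` (provable now from Pratt Prop 3.3, tree
  `sum_card_mul_le_prattVal_of_addSimultaneousTPP`).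
* card `label-weighted-stpp-debordering`: `IsLabelWeightedSTPP`, `WeightedThinPackings`,
  `Debordering` (provable now: tensor power + pigeonhole on label-weight sums).
-/

namespace Summit.MatrixMultiplication.MatrixMultiplication.Cruxes.ThinPackings.Ideator3

open Finset
open Literature.Computability.AlgebraicComplexity

/-! ## Card 1: three-sphere orthogonal frames (norm grading) -/

/-- Squared Euclidean norm / inner product on `ℤ^D`, written as explicit sums. -/
def ip {D : ℕ} (v w : Fin D → ℤ) : ℤ := ∑ t, v t * w t

/-- **Three-sphere pair collapse** (first lemma of card `three-sphere-frame-designs`, provable now):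
if every block is an orthogonal frame — elements of `A i`, `B i`, `C i` pairwise orthogonal — and
the three sets lie on spheres of radii `rA, rB, rC` (the same radii for all blocks), then the STPP
is EQUIVALENT to the three packing conditions (tiles `C−A`, `B−A`, `B−C` pairwise disjoint across
blocks, with unique representation) together with the all-distinct-label clause; the TPP of each
block and every two-label cross condition are discharged by Pythagoras. -/
def ThreeSpherePairCollapse : Prop :=
  ∀ (D L : ℕ) (A B C : Fin L → Finset (Fin D → ℤ)) (rA rB rC : ℤ),
    (∀ i, ∀ a ∈ A i, ip a a = rA) → (∀ i, ∀ b ∈ B i, ip b b = rB) → (∀ i, ∀ c ∈ C i, ip c c = rC) →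
    (∀ i, ∀ a ∈ A i, ∀ b ∈ B i, ip a b = 0) → (∀ i, ∀ a ∈ A i, ∀ c ∈ C i, ip a c = 0) →
    (∀ i, ∀ b ∈ B i, ∀ c ∈ C i, ip b c = 0) →
    (IsSTPP A B C ↔
      ((∀ i k, ∀ a ∈ A i, ∀ c ∈ C i, ∀ a' ∈ A k, ∀ c' ∈ C k, c - a = c' - a' → i = k ∧ a = a' ∧ c = c') ∧
       (∀ i k, ∀ a ∈ A i, ∀ b ∈ B i, ∀ a' ∈ A k, ∀ b' ∈ B k, b - a = b' - a' → i = k ∧ a = a' ∧ b = b') ∧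
       (∀ i k, ∀ b ∈ B i, ∀ c ∈ C i, ∀ b' ∈ B k, ∀ c' ∈ C k, b - c = b' - c' → i = k ∧ b = b' ∧ c = c') ∧
       (∀ i j k : Fin L, i ≠ j → j ≠ k → i ≠ k →
          ∀ s ∈ A k, ∀ s' ∈ A i, ∀ t ∈ B i, ∀ t' ∈ B j, ∀ u ∈ C j, ∀ u' ∈ C k,
            (s' - s) + (t' - t) + (u' - u) ≠ 0)))

/-- **Super-linear Val** (the cyclic gateway; negation of Pratt 2024 Conj. 4.1): `Val(ℤ/nℤ) ≥ n^{1+c}`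
for some fixed `c > 0` and infinitely many `n`. Tree: `prattVal`. -/
def SuperlinearVal : Prop :=
  ∃ c : ℝ, 0 < c ∧ ∀ n₀ : ℕ, ∃ n : ℕ, n₀ ≤ n ∧
    ((n + 1 : ℕ) : ℝ) ^ (1 + c) ≤ (prattVal (ZMod (n + 1)) : ℝ)

/-- **Cyclic thin rung** at shape exponent `a` with polynomial blocks (`N ≥ |H|^θ`): the crux
`ThinPackings` restricted to cyclic hosts `ℤ/Qℤ` and to blocks of polynomial size — the form every
Behrend/sphere design (card 1) would deliver after Freiman embedding of a `ℤ^D`-box. -/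
def CyclicThinRung (a θ : ℝ) : Prop :=
  ∀ η : ℝ, 0 < η → ∃ (Q L N M : ℕ) (A B C : Fin L → Finset (ZMod (Q + 1))),
    IsSTPP A B C ∧ (∀ i, (A i).card = N ∧ (B i).card = M ∧ (C i).card = N) ∧ 2 ≤ N ∧
    (N : ℝ) ^ a ≤ M ∧ ((Q + 1 : ℕ) : ℝ) ^ θ ≤ N ∧ ((Q + 1 : ℕ) : ℝ) ≤ L * (N : ℝ) ^ (2 + η)

/-- Transfer (provable now from Pratt Prop. 3.3 = tree `sum_card_mul_le_prattVal_of_addSimultaneousTPP`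
and `isSTPP_iff_addSimultaneousTPP`): a cyclic thin rung at any `a > 0` with polynomial blocks gives
super-linear `Val` (`Σ|A||B||C| = L N² M ≥ (Q+1) N^{a-η} ≥ (Q+1)^{1+θ(a-η)}`). -/
def CyclicRungGivesSuperlinearVal : Prop :=
  ∀ a θ : ℝ, 0 < a → 0 < θ → CyclicThinRung a θ → SuperlinearVal

/-- The cyclic rung implies the crux pointwise in `a` (trivial: forget the host restriction). -/
theorem cyclicThinRung_thin (h : ∀ a : ℝ, 0 ≤ a → a < 1 → ∃ θ : ℝ, 0 < θ ∧ CyclicThinRung a θ) :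
    Summit.MatrixMultiplication.MatrixMultiplication.Theses.ThinBlockAlpha.ThinPackings := by
  intro a ha0 ha1 η hη
  obtain ⟨θ, -, hr⟩ := h a ha0 ha1
  obtain ⟨Q, L, N, M, A, B, C, hS, hc, hN, hM, -, hP⟩ := hr η hη
  refine ⟨ZMod (Q + 1), inferInstance, inferInstance, L, N, M, A, B, C, hS, hc, hN, hM, ?_⟩
  simpa [ZMod.card] using hP

/-! ## Card 2: label-weighted STPP (combinatorial degeneration) and de-bordering -/

/-- **Label-weighted STPP** (border-STPP with block-constant potentials `κ, μ`): the three packings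
and the TPP of each block are kept as HARD clauses (they make the index sets `⊔(Aᵢ−Bᵢ)`, `⊔(Bⱼ−Cⱼ)`,
`⊔(C_k−A_k)` of the group tensor well defined); a CROSS relation with labels not all equal is
allowed provided its weight `(κ i − κ k) + (μ j − μ k)` is `≥ 1` (monomial degeneration of the
group tensor `T_H` restricted to the index sets onto `⊕ᵢ ⟨|Aᵢ|,|Bᵢ|,|Cᵢ|⟩`, with potentials
`w_X = κ i` on `Aᵢ−Bᵢ`, `w_Y = μ j` on `Bⱼ−Cⱼ`, `w_Z = −κ k − μ k` on `C_k−A_k`). `IsSTPP` is the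
case where the last clause is vacuous. -/
def IsLabelWeightedSTPP {H : Type*} [AddCommGroup H] {L : ℕ} (A B C : Fin L → Finset H)
    (κ μ : Fin L → ℤ) : Prop :=
  (∀ i k, ∀ s ∈ A i, ∀ t ∈ B i, ∀ s' ∈ A k, ∀ t' ∈ B k, s - t = s' - t' → i = k ∧ s = s' ∧ t = t') ∧
  (∀ j k, ∀ t ∈ B j, ∀ u ∈ C j, ∀ t' ∈ B k, ∀ u' ∈ C k, t - u = t' - u' → j = k ∧ t = t' ∧ u = u') ∧
  (∀ i k, ∀ u ∈ C i, ∀ s ∈ A i, ∀ u' ∈ C k, ∀ s' ∈ A k, u - s = u' - s' → i = k ∧ u = u' ∧ s = s') ∧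
  (∀ i, ∀ s ∈ A i, ∀ s' ∈ A i, ∀ t ∈ B i, ∀ t' ∈ B i, ∀ u ∈ C i, ∀ u' ∈ C i,
      (s' - s) + (t' - t) + (u' - u) = 0 → s = s' ∧ t = t' ∧ u = u') ∧
  (∀ i j k : Fin L, ¬ (i = j ∧ j = k) →
      ∀ s ∈ A k, ∀ s' ∈ A i, ∀ t ∈ B i, ∀ t' ∈ B j, ∀ u ∈ C j, ∀ u' ∈ C k,
        (s' - s) + (t' - t) + (u' - u) = 0 → 1 ≤ (κ i - κ k) + (μ j - μ k))

/-- `IsSTPP` families are label-weighted STPP for every choice of weights (sanity, provable now). -/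
def STPPIsWeighted : Prop :=
  ∀ (H : Type) [AddCommGroup H] (L : ℕ) (A B C : Fin L → Finset H) (κ μ : Fin L → ℤ),
    IsSTPP A B C → IsLabelWeightedSTPP A B C κ μ

/-- **Weighted thin packings**: the crux with `IsSTPP` relaxed to `IsLabelWeightedSTPP` (C⁺ of the
Transfer; same packing numerology, strictly larger design space). -/
def WeightedThinPackings : Prop :=
  ∀ a : ℝ, 0 ≤ a → a < 1 → ∀ η : ℝ, 0 < η → ∃ (H : Type) (_ : AddCommGroup H) (_ : Fintype H)
    (L N M : ℕ) (A B C : Fin L → Finset H) (κ μ : Fin L → ℤ), IsLabelWeightedSTPP A B C κ μ ∧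
    (∀ i, (A i).card = N ∧ (B i).card = M ∧ (C i).card = N) ∧ 2 ≤ N ∧ (N : ℝ) ^ a ≤ M ∧
    (Fintype.card H : ℝ) ≤ L * (N : ℝ) ^ (2 + η)

/-- **De-bordering** (first lemma of card `label-weighted-stpp-debordering`, provable now — the STPP
analogue of BCCGNSU 2017 Lemma 3.4): in `H^n` keep the product blocks whose label words have
prescribed weight sums `(Σ κ, Σ μ) = (α, β)`; a surviving zero-sum relation has total weight `0`
with nonnegative coordinate weights, hence is coordinatewise trivial — a genuine `IsSTPP` family of
`≥ Lⁿ/(n·range+1)²` blocks `⟨Nⁿ, Mⁿ, Nⁿ⟩` in `H^n`; the loss is `|Hⁿ|^{o(1)}`, so the packing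
exponent `η` is preserved in the limit. -/
def Debordering : Prop :=
  WeightedThinPackings → Summit.MatrixMultiplication.MatrixMultiplication.Theses.ThinBlockAlpha.ThinPackings

/-- The finite core of de-bordering, one tensor power at a time (provable now). -/
def DeborderingPower : Prop :=
  ∀ (H : Type) [AddCommGroup H] [Fintype H] [DecidableEq H] (L N M : ℕ) (A B C : Fin L → Finset H)
    (κ μ : Fin L → ℤ) (R : ℕ), IsLabelWeightedSTPP A B C κ μ →
    (∀ i, (A i).card = N ∧ (B i).card = M ∧ (C i).card = N) → (∀ i, |κ i| ≤ R ∧ |μ i| ≤ R) →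
    ∀ n : ℕ, ∃ (L' : ℕ) (A' B' C' : Fin L' → Finset (Fin n → H)),
      IsSTPP A' B' C' ∧ (∀ i, (A' i).card = N ^ n ∧ (B' i).card = M ^ n ∧ (C' i).card = N ^ n) ∧
      L ^ n ≤ L' * (2 * n * R + 1) ^ 2

end Summit.MatrixMultiplication.MatrixMultiplication.Cruxes.ThinPackings.Ideator3
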